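import Summits.BirchSwinnertonDyer.BirchSwinnertonDyer.Theorems.QuadraticBranchSignedControlPlusEtaNonsurjFineRoadAnchor
import Summits.BirchSwinnertonDyer.BirchSwinnertonDyer.Theorems.KatoDescentPotSupersingularWildFineSelmerCMFineUnitAnchor
import HarnessLib

/-!
# Route `QuadraticBranchSignedControl` (rung K8, cell `bsd-potss`), residual crux
# `PlusEtaMainConjectureNonsurj` (stmt-BirchSwinnertonDyer-19606): the FINE ROAD, part 4 — the UNIT-ANCHOR
# road WITHOUT Hatley–Lei: (A) at a congruent rank-0 unit anchor is a TREE THEOREM (K9's fine control,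
# `WildFineSelmerFineUnitAnchor`; CM form modulo bsd.S28), (A) transfers by Lim–Sujatha (PROVED), and the fine
# road turns it into `μ(X⁺(V/K_∞)^η) = 0` (seat `bsd-potss-k8eta-c2` g6)

WHAT. Seats g3–g5 settled the 9 «unit-anchored» non-CM rank-`1` rows and re-derived the non-CM rank-`0`
unit rows of crux 19606 through the Hatley–Lei `μ`-transfer (`EtaCongruentAnchorByName.hHL_of_thm46`, named
fact `HatleyLei2019.thm46_…` = wi-78102, D-audit «VERBATIM-COMPOSITE»): a UNIT row `W′` congruent to `W` mod
`p` forces `μ(X⁺(V/K_∞)^η) = 0`. Parts 1–3 of the fine road give a SECOND, independent road to the same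
conclusion whose transfer step is PROVED: (A)(W′,p) for a rank-`0` anchor with `p ∤ #Ш(W′)·Tam(W′)` and
`W′(ℚ_p)[p] = 0` is the K9 lane's kernel theorem `WildFineSelmerFineUnitAnchorTamagawa.conjA_rat_of_fineUnitData_tamagawa`
(Greenberg's fine control, unconditional; CM form `WildFineSelmerCMFineUnitAnchor.conjA_rat_of_cmFineUnitData_tamagawa`
with the global data `rank 0 ∧ Ш[p] = 0` from `r_an = 0 ∧ p ∤ #Ш_an` by bsd.S28 = Burungale–Flach), (A)
transfers to `W` by `LimSujatha2018.prop32_…_holds`, and part 2's `eta_hasUnitContent_of_conjA_of_analyticMu`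
concludes modulo Kobayashi's Thm. 6.2/6.3/7.3 i)/Cor. 7.2 at `η` (`h6273`) and the analytic `μ` (free on
prime-`L` rows). So on those rows the cite-only Thm. 4.6 of Hatley–Lei is REPLACEABLE by Kobayashi's own
§§6–7 + two tree theorems.
* §7 `conjA_of_congruent_cmUnitAnchor` (hS28, hmod), `conjA_of_congruent_unitAnchor` (hGZK; any anchor with
  `rank`/`Ш` data); `quadraticBranchPlusEtaMainConjectureAt_of_span_eq_span_X_of_congruent_cmUnitAnchor` (the
  prime-`L` rank-`1` row: (C1⁺_η)(V) ⟸ a congruent CM rank-`0` unit anchor, h22/h41/h6273/hS28/hmod — the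
  Hatley–Lei-free twin of `EtaPrimeRoadByName.…_of_modPCongruent_unitRow_…`); the rank-`0` `p`-unit-`Ш_an`
  row form `…_of_congruent_cmUnitAnchor_of_shaAn_unit`.
In-table (census kit j277504 + KO92 j270119/j270714): anchors 900b1, 3600bb1, 10800cj1, 14400cz1, 11025e1 are
CM rank-`0` unit rows; they carry the non-CM rows 26100c1/h1, 104400cr1/dc1, 243900o1/p1, 313200ek1/el1,
458100m1/j1, 341775ca1/dj1, 417600je1/ke1.

HONEST FRAMING (cell `bsd-potss`; FULL-BSD rank ≤ 1 programme, HUMAN RULING D-0036/D-0074): BOOKKEEPING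
THEOREMS ONLY — no definition, no named fact minted, no `sorry`, axioms standard. CONDITIONAL on the displayed
named facts (`h6273`, `h22`, `h41`, `hS28`, `hmod`, `hGZK`, `hPT`, `hKO`) and DISPLAYED per-row inputs (the
torsion isomorphism = a Kraus–Oesterlé certificate; the anchor's `r_an = 0`, `#Ш_an = m`, `p ∤ m·Tam`; the
anchor's local test `W′(ℚ_p)[p] = 0` — true on every Gss2 partner by the inertia argument of the g6 FINDING
§2 but displayed, as in the K9 files; the analytic `μ` / `(L_p⁺) = (X)` / `#Ш(W)_an`). No stub of 19606 is
proved by name; the crux stays OPEN; nothing is booked; `BSD(W,p)` is claimed for no pair.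
`--supports stmt-BirchSwinnertonDyer-19606`.

References: [GreenbergLNM1716] Prop. 3.8, §3 Lemma 3.3; [LimSujatha2018] §3 Prop. 3.2; [BurungaleFlach2024]
Thm. 1.1, Cor. 2; [Kobayashi2003] Thm. 7.3 i) (7.21), §4 + Thm. 4.1 (p. 8); [CoatesSujatha2005] §3 (A);
[HatleyLei2019] Thm. 4.6 (the road replaced); [KrausOesterle1992] Prop. 4.
-/

set_option autoImplicit false
set_option linter.dupNamespace false

noncomputable section

open scoped Classical

open CongruenceSubgroup Field Function NumberField IsDedekindDomain WeierstrassCurve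
open Literature.NumberTheory.EllipticCurves
open Literature.NumberTheory.EllipticCurves.ModularForms
open Literature.NumberTheory.EllipticCurves.Rank1Residual
open Literature.NumberTheory.EllipticCurves.Rank1Residual.Typed
open Literature.NumberTheory.GaloisRepresentations
open Literature.NumberTheory.GaloisCohomology
open Literature.NumberTheory.EllipticCurves.IwasawaAlgebra
open Literature.NumberTheory.EllipticCurves.IwasawaDual ZpExtension
open Literature.NumberTheory.EllipticCurves.GreenbergVatsal2000
open Summit.BirchSwinnertonDyer.Rank1Residual.X11b.Levels
open Summit.BirchSwinnertonDyer.Rank1Residual.X11b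
open Summit.BirchSwinnertonDyer.Rank1Residual.Additive
open Summit.BirchSwinnertonDyer.Rank1Residual.Additive.SignedTwist
open scoped ContRepresentation
open Summit.BirchSwinnertonDyer.Rank1Residual.AdditivePotMult

namespace Summit.BirchSwinnertonDyer.BirchSwinnertonDyer.Theorems

open Literature.NumberTheory.EllipticCurves.GreenbergSelmer (decomp)

namespace EtaFineRoad


/-! ## §7 (A) at a congruent rank-`0` unit anchor is a tree theorem; the Hatley–Lei-free unit-anchor road -/

section UnitAnchor

variable (W : WeierstrassCurve ℚ) [W.IsElliptic] [W.IsGloballyMinimal] (p : ℕ) [hp : Fact p.Prime]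

omit [W.IsGloballyMinimal] in
/-- **(A)(W,p) from a congruent CM rank-`0` unit anchor** (bsd.S28 + fine control + Lim–Sujatha): `p` odd,
`W[p] ≅ W′[p]` (`Γ_ℚ`-equivariantly), `W′/ℚ` globally minimal with CM, `r_an(W′) = 0`, `#Ш(W′)_an = m` with
`p ∤ m`, `p ∤ Tam(W′)`, and no non-zero `D_v`-fixed `p`-torsion of `W′[p^∞]` at the places `v ∣ p` of a finite
`S` off which `W′` is good and `v ∤ p` `⟹` (A)(W,p) in the cell's currency. = `conjA_of_torsionIso_of_conjA` ∘
`WildFineSelmerCMFineUnitAnchor.conjA_rat_of_cmFineUnitData_tamagawa`. CONDITIONAL on `hS28`, `hmod`.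
[cite: BurungaleFlach2024, Thm. 1.1 and Cor. 2] [cite: GreenbergLNM1716, Prop. 3.8 (pp. 95–96) and §3 Lemma 3.3]
[cite: LimSujatha2018, §3 Prop. 3.2] -/
theorem conjA_of_congruent_cmUnitAnchor (hS28 : bsdTriple_of_hasCM_of_L_one_ne_zero)
    (hmod : hasEntireLFunction_rat) (hp2 : p ≠ 2) (W' : WeierstrassCurve ℚ) [W'.IsElliptic] [W'.IsGloballyMinimal]
    (hcong : ∃ e : W.geomTorsion (p : ℤ) ≃+ W'.geomTorsion (p : ℤ),
      ∀ (σ : absoluteGaloisGroup ℚ) (P : W.geomTorsion (p : ℤ)), e (σ • P) = σ • e P)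
    (hcm : W'.HasCM) (hr : W'.analyticRank = 0) {m : ℕ} (hm : shaAn W' = (m : ℂ)) (hpm : ¬ p ∣ m)
    (htam : ¬ p ∣ W'.tamagawaProduct) (S : Finset (HeightOneSpectrum (𝓞 ℚ)))
    (hS : ∀ v ∉ S, ((p : ℕ) : 𝓞 ℚ) ∉ v.asIdeal ∧ W'.HasGoodReductionAt v)
    (hlocp : ∀ v ∈ S, ((p : ℕ) : 𝓞 ℚ) ∈ v.asIdeal →
      ∀ x : W'.geomPrimaryTorsion p, p • x = 0 → (∀ d ∈ decomp v, d • x = x) → x = 0) :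
    ∀ (κ : ZpExtension ℚ p), κ.IsCyclotomic →
      ∃ (γ : absoluteGaloisGroup ℚ) (D : W.FineSelmerDualData κ γ),
        Module.Finite ℤ_[p] (RestrictScalars ℤ_[p] (IwasawaAlgebra p) D.X) :=
  conjA_of_torsionIso_of_conjA W p hp2 W' hcong
    (WildFineSelmerCMFineUnitAnchor.conjA_rat_of_cmFineUnitData_tamagawa hS28 hmod W' hcm hr hm hpm htam S hS
      hlocp)

omit [W.IsGloballyMinimal] in
/-- **(A)(W,p) from a congruent rank-`0` unit anchor of any kind** (Gross–Zagier–Kolyvagin for `rank = r_an = 0`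
and `Ш` finite; `p ∤ #Ш(W′)` DISPLAYED as algebraic input; the local test at every `v ∈ S`):
`WildFineSelmerFineUnitAnchor.conjA_rat_of_analyticRankZero_of_fineUnitData` ∘ Lim–Sujatha. For the non-CM unit
members of g5's clusters. CONDITIONAL on `hGZK`. [cite: GreenbergLNM1716, Prop. 3.8 (pp. 95–96)]
[cite: LimSujatha2018, §3 Prop. 3.2] [cite: CoatesSujatha2005, §3 (A)] -/
theorem conjA_of_congruent_unitAnchor (hGZK : rank_eq_analyticRank_of_analyticRank_le_one) (hp2 : p ≠ 2)
    (W' : WeierstrassCurve ℚ) [W'.IsElliptic]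
    (hcong : ∃ e : W.geomTorsion (p : ℤ) ≃+ W'.geomTorsion (p : ℤ),
      ∀ (σ : absoluteGaloisGroup ℚ) (P : W.geomTorsion (p : ℤ)), e (σ • P) = σ • e P)
    (hr : W'.analyticRank = 0) (hsha : ¬ p ∣ Nat.card W'.sha) (S : Finset (HeightOneSpectrum (𝓞 ℚ)))
    (hS : ∀ v ∉ S, ((p : ℕ) : 𝓞 ℚ) ∉ v.asIdeal ∧ W'.HasGoodReductionAt v)
    (hloc : ∀ v ∈ S, ∀ x : W'.geomPrimaryTorsion p, p • x = 0 → (∀ d ∈ decomp v, d • x = x) → x = 0) :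
    ∀ (κ : ZpExtension ℚ p), κ.IsCyclotomic →
      ∃ (γ : absoluteGaloisGroup ℚ) (D : W.FineSelmerDualData κ γ),
        Module.Finite ℤ_[p] (RestrictScalars ℤ_[p] (IwasawaAlgebra p) D.X) :=
  conjA_of_torsionIso_of_conjA W p hp2 W' hcong
    (WildFineSelmerFineUnitAnchor.conjA_rat_of_analyticRankZero_of_fineUnitData hGZK W' S hS hr hsha hloc)

omit [W.IsGloballyMinimal] in
/-- **Prime-`L` rank-`1` row from a congruent CM rank-`0` unit anchor, WITHOUT Hatley–Lei** — the twin of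
g5's `EtaPrimeRoadByName` road with `h46` replaced by `h6273` + bsd.S28 + two tree theorems: `p ≥ 5`,
`C • W^{(p*)} = V`, good, `a_p(V) = 0`, `Sel_{p^∞}(W/ℚ)` infinite, `(L_p⁺(V,η,X)) = (X)`; anchor `W′` as in
`conjA_of_congruent_cmUnitAnchor` `⟹` (C1⁺_η)(V). In-table: the 9 unit-anchored non-CM rank-`1` rows (anchors
900b1, 3600bb1, 10800cj1, 14400cz1, 11025e1). CONDITIONAL on `h22`, `h41`, `h6273`, `hS28`, `hmod`; nothing booked.
[cite: Kobayashi2003, §4 and Thm. 4.1 first display (p. 8), Thm. 7.3 i) (p. 13)] [cite: BurungaleFlach2024, Thm. 1.1 and Cor. 2]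
[cite: LimSujatha2018, §3 Prop. 3.2] -/
theorem quadraticBranchPlusEtaMainConjectureAt_of_span_eq_span_X_of_congruent_cmUnitAnchor
    (h22 : Kobayashi2003.thm22_etaSignedSelmerDual_finite_torsion)
    (h41 : Kobayashi2003.thm41_plusEtaCharIdeal_dvd)
    (h6273 : Kobayashi2003.thm62_63_73_etaColemanPoitouTate)
    (hS28 : bsdTriple_of_hasCM_of_L_one_ne_zero) (hmod : hasEntireLFunction_rat)
    (V : WeierstrassCurve ℚ) [V.IsElliptic] [V.IsGloballyMinimal] (C : VariableChange ℚ)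
    (hp5 : 5 ≤ p) (hCV : C • W.quadraticTwist ((-1) ^ (p / 2) * p) = V)
    (hgood : V.HasGoodReductionAtPrime p) (hap : V.frobeniusTrace p = 0)
    (hinf : ¬ Finite ↥(W.selmerGroupPInfty p))
    (hX : ∀ {N : ℕ} [NeZero N] {f : CuspForm (Gamma0 N) 2}, IsNewformOf V f →
      ∀ (ϖ : ℚ), (if Even (p / 2) then (ϖ : ℝ) * V.realPeriodRat = plusPeriod f
          else (ϖ : ℝ) * V.imaginaryPeriodRat = minusPeriod f) →
      ∀ (Lη : IwasawaAlgebra p), IsQuadraticBranchPlusLFunction f p ϖ Lη →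
        Ideal.span {Lη} = Ideal.span {(PowerSeries.X : IwasawaAlgebra p)})
    (W' : WeierstrassCurve ℚ) [W'.IsElliptic] [W'.IsGloballyMinimal]
    (hcong : ∃ e : W.geomTorsion (p : ℤ) ≃+ W'.geomTorsion (p : ℤ),
      ∀ (σ : absoluteGaloisGroup ℚ) (P : W.geomTorsion (p : ℤ)), e (σ • P) = σ • e P)
    (hcm : W'.HasCM) (hr : W'.analyticRank = 0) {m : ℕ} (hm : shaAn W' = (m : ℂ)) (hpm : ¬ p ∣ m)
    (htam : ¬ p ∣ W'.tamagawaProduct) (S : Finset (HeightOneSpectrum (𝓞 ℚ)))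
    (hS : ∀ v ∉ S, ((p : ℕ) : 𝓞 ℚ) ∉ v.asIdeal ∧ W'.HasGoodReductionAt v)
    (hlocp : ∀ v ∈ S, ((p : ℕ) : 𝓞 ℚ) ∈ v.asIdeal →
      ∀ x : W'.geomPrimaryTorsion p, p • x = 0 → (∀ d ∈ decomp v, d • x = x) → x = 0) :
    QuadraticBranchPlusEtaMainConjectureAt V p :=
  have hp2 : p ≠ 2 := by omega
  quadraticBranchPlusEtaMainConjectureAt_of_span_eq_span_X_of_conjA W p h22 h41 h6273 V C hp5 hCV hgood hap
    hinf hX (conjA_of_congruent_cmUnitAnchor W p hS28 hmod hp2 W' hcong hcm hr hm hpm htam S hS hlocp)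

/-- **Rank-`0` row with `p`-unit analytic `#Ш(W)` from a congruent CM rank-`0` unit anchor, WITHOUT Hatley–Lei**:
as `…FineRoadAnchor.quadraticBranchPlusEtaMainConjectureAt_of_congruent_conjA_of_shaAn_unit` with the anchor's (A)
DISCHARGED by `conjA_of_congruent_cmUnitAnchor`; the analytic `μ(L_p⁺(V,η,X)) = 0` stays displayed. In-table: the
non-CM rank-`0` unit rows 26100c1, 104400cr1, 313200ek1, 417600je1, 458100m1 (a second road to g2's).
CONDITIONAL on `hPT`, `hmod`, `hGZK`, `h22`, `h41`, `hKO`, `h6273`, `hS28`; nothing booked.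
[cite: Kobayashi2003, §4 and Thm. 4.1 (p. 8)] [cite: BurungaleFlach2024, Thm. 1.1 and Cor. 2] [cite: Miller2011LMS, Def. 1.1] -/
theorem quadraticBranchPlusEtaMainConjectureAt_of_congruent_cmUnitAnchor_of_shaAn_unit
    (hPT : poitouTate_selmerStructure_duality_real ℚ) (hmod : hasEntireLFunction_rat)
    (hGZK : rank_eq_analyticRank_of_analyticRank_le_one)
    (h22 : Kobayashi2003.thm22_etaSignedSelmerDual_finite_torsion)
    (h41 : Kobayashi2003.thm41_plusEtaCharIdeal_dvd)
    (hKO : KitajimaOtsuki2018.mainThm13_etaSignedSelmerDual_noFiniteSubmodule)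
    (h6273 : Kobayashi2003.thm62_63_73_etaColemanPoitouTate)
    (hS28 : bsdTriple_of_hasCM_of_L_one_ne_zero)
    (V : WeierstrassCurve ℚ) [V.IsElliptic] [V.IsGloballyMinimal] (C : VariableChange ℚ)
    (hp5 : 5 ≤ p) (hCV : C • W.quadraticTwist ((-1) ^ (p / 2) * p) = V)
    (hgood : V.HasGoodReductionAtPrime p) (hap : V.frobeniusTrace p = 0)
    (hLW : W.entireLFunction 1 ≠ 0) {q : ℚ} (hq : shaAn W = (q : ℂ)) (hv : padicValRat p q = 0)
    (hμan : ∀ {N : ℕ} [NeZero N] {f : CuspForm (Gamma0 N) 2}, IsNewformOf V f →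
      ∀ (ϖ : ℚ), (if Even (p / 2) then (ϖ : ℝ) * V.realPeriodRat = plusPeriod f
          else (ϖ : ℝ) * V.imaginaryPeriodRat = minusPeriod f) →
      ∀ (Lη : IwasawaAlgebra p), IsQuadraticBranchPlusLFunction f p ϖ Lη → HasUnitContent Lη)
    (W' : WeierstrassCurve ℚ) [W'.IsElliptic] [W'.IsGloballyMinimal]
    (hcong : ∃ e : W.geomTorsion (p : ℤ) ≃+ W'.geomTorsion (p : ℤ),
      ∀ (σ : absoluteGaloisGroup ℚ) (P : W.geomTorsion (p : ℤ)), e (σ • P) = σ • e P)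
    (hcm : W'.HasCM) (hr : W'.analyticRank = 0) {m : ℕ} (hm : shaAn W' = (m : ℂ)) (hpm : ¬ p ∣ m)
    (htam : ¬ p ∣ W'.tamagawaProduct) (S : Finset (HeightOneSpectrum (𝓞 ℚ)))
    (hS : ∀ v ∉ S, ((p : ℕ) : 𝓞 ℚ) ∉ v.asIdeal ∧ W'.HasGoodReductionAt v)
    (hlocp : ∀ v ∈ S, ((p : ℕ) : 𝓞 ℚ) ∈ v.asIdeal →
      ∀ x : W'.geomPrimaryTorsion p, p • x = 0 → (∀ d ∈ decomp v, d • x = x) → x = 0) :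
    QuadraticBranchPlusEtaMainConjectureAt V p :=
  have hp2 : p ≠ 2 := by omega
  ConverseControl.quadraticBranchPlusEtaMainConjectureAt_of_etaUpperIntegral_of_missingLowerBoundAt W p
    hPT hmod hGZK h22 hKO V C hp5 hCV hgood hap
    (etaUpperIntegral_of_conjA_of_analyticMu W p h22 h41 h6273 V C hCV
      (conjA_of_congruent_cmUnitAnchor W p hS28 hmod hp2 W' hcong hcm hr hm hpm htam S hS hlocp) hμan)
    hLW ⟨q, hq, by rw [hv]; exact_mod_cast Nat.zero_le _⟩

end UnitAnchor

end EtaFineRoad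

end Summit.BirchSwinnertonDyer.BirchSwinnertonDyer.Theorems

end
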